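import Summits.AtomisticToContinuum.Crystallization.Theorems.ExcessDecayLiouvillePoincare
import Summits.AtomisticToContinuum.Crystallization.Theorems.ExcessDecayLiouvilleVerticalDifferences

/-!
# Route `ExcessDecayLiouville`: iterated translation differences are dominated by the strain form

First half of (LR) (`LongRangeDifferences`) of the energy route for item `ExcessDecay` (stmt-AtomisticToContinuum-9334;
evidence v4, F2).  For a finitely supported displacement `v`, a lattice vector `τ ∈ Λ₀` along which single-step
differences are dominated by `M · nnForm` (`M = 1` for the nearest-neighbour translations `±u₁, ±u₂`, `M = 4` for the
vertical period `±w₃`), and `L : ℕ` steps: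

`Σ'_p ‖v (p + L·Aτ) − v p‖² ≤ M · L² · nnForm t A v`   (`tsum_norm_sub_iterate_sq_le`),

by telescoping (`sub_eq_sum_diff`), Cauchy–Schwarz, and the invariance of `Σ'_p` under the site shifts
(`exists_sitesShift`).  Corollaries for `±u₁, ±u₂` (`M = 1`) and `±w₃` (`M = 4`) with an integer number of steps
(`tsum_norm_sub_zsmul_translate_sq_le`, `tsum_norm_sub_zsmul_vertical_sq_le`).
All `[folklore]`; helper lemmas, nothing here closes an item.
-/

noncomputable section

namespace Summit.AtomisticToContinuum.Crystallization.Theorems.ExcessDecayLiouville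

open scoped BigOperators Topology InnerProductSpace RealInnerProductSpace Classical
open Literature.MathematicalPhysics.StatisticalMechanics
open Summit.AtomisticToContinuum.Crystallization.Theorems.PhononStabilityNegative

section

variable {t : Fin 2 → (EuclideanSpace ℝ (Fin 3))} {A : (EuclideanSpace ℝ (Fin 3)) →L[ℝ] (EuclideanSpace ℝ (Fin 3))}

/-- Natural multiples of lattice vectors are lattice vectors. [folklore] -/
theorem nsmul_mem_Λ₀ {τ : (EuclideanSpace ℝ (Fin 3))} (hτ : τ ∈ Λ₀) (s : ℕ) : (s : ℝ) • τ ∈ Λ₀ := by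
  induction s with
  | zero =>
    rw [Nat.cast_zero, zero_smul]
    have h0 := hcpLiouvilleLam_sub_mem hτ hτ
    rw [sub_self] at h0
    exact h0
  | succ n ih =>
    have : ((n + 1 : ℕ) : ℝ) • τ = (n : ℝ) • τ + τ := by push_cast; rw [add_smul, one_smul]
    rw [this]
    exact hcpLiouvilleLam_add_mem ih hτ

/-- Pointwise telescoping + Cauchy–Schwarz along `L` steps of `Aτ`:
`‖v (p + L·Aτ) − v p‖² ≤ L · Σ_{s<L} ‖v (p + (s+1)·Aτ) − v (p + s·Aτ)‖²`. [folklore] -/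
theorem norm_sub_iterate_sq_le (v : (EuclideanSpace ℝ (Fin 3)) → (EuclideanSpace ℝ (Fin 3))) (p τ' : (EuclideanSpace ℝ (Fin 3))) (L : ℕ) :
    ‖v (p + (L : ℝ) • τ') - v p‖ ^ 2 ≤ (L : ℝ) * ∑ s ∈ Finset.range L,
      ‖v (p + ((s + 1 : ℕ) : ℝ) • τ') - v (p + (s : ℝ) • τ')‖ ^ 2 := by
  set g : ℕ → (EuclideanSpace ℝ (Fin 3)) := fun s => v (p + (s : ℝ) • τ') with hg
  have h0 : g 0 = v p := by simp [hg]
  have htel := sub_eq_sum_diff g L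
  rw [h0] at htel
  have hnorm : ‖v (p + (L : ℝ) • τ') - v p‖ ≤ ∑ s ∈ Finset.range L, ‖g (s + 1) - g s‖ := by
    have : v (p + (L : ℝ) • τ') - v p = g L - v p := rfl
    rw [this, htel]
    exact norm_sum_le _ _
  have hcs : (∑ s ∈ Finset.range L, ‖g (s + 1) - g s‖) ^ 2 ≤ L * ∑ s ∈ Finset.range L, ‖g (s + 1) - g s‖ ^ 2 := by
    have := sq_sum_le_card_mul_sum_sq (s := Finset.range L) (f := fun s => ‖g (s + 1) - g s‖)
    simpa [Finset.card_range] using this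
  exact (pow_le_pow_left₀ (norm_nonneg _) hnorm 2).trans hcs

/-- **Iterated differences along a lattice period are dominated by the strain form**:
`Σ'_p ‖v (p + L·Aτ) − v p‖² ≤ M · L² · nnForm t A v` whenever the single steps satisfy
`Σ'_p ‖v p − v (p + Aτ)‖² ≤ M · nnForm t A v` for all finitely supported `v`. [folklore] -/
theorem tsum_norm_sub_iterate_sq_le
    {v : (EuclideanSpace ℝ (Fin 3)) → (EuclideanSpace ℝ (Fin 3))} (hv : (Function.support v).Finite) {τ : (EuclideanSpace ℝ (Fin 3))} (hτ : τ ∈ Λ₀) {M : ℝ}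
    (hdom : ∀ w : (EuclideanSpace ℝ (Fin 3)) → (EuclideanSpace ℝ (Fin 3)), (Function.support w).Finite →
      ∑' p : Sites₀ t A, ‖w p - w ((p : (EuclideanSpace ℝ (Fin 3))) + A τ)‖ ^ 2 ≤ M * nnForm t A w) (L : ℕ) :
    ∑' p : Sites₀ t A, ‖v ((p : (EuclideanSpace ℝ (Fin 3))) + (L : ℝ) • A τ) - v p‖ ^ 2 ≤ M * (L : ℝ) ^ 2 * nnForm t A v := by
  classical
  -- each shifted single-step family is summable with tsum ≤ M·nnForm
  have hsingle := hdom v hv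
  have hstep : ∀ s : ℕ, (Summable fun p : Sites₀ t A =>
      ‖v ((p : (EuclideanSpace ℝ (Fin 3))) + ((s + 1 : ℕ) : ℝ) • A τ) - v ((p : (EuclideanSpace ℝ (Fin 3))) + (s : ℝ) • A τ)‖ ^ 2) ∧
      ∑' p : Sites₀ t A, ‖v ((p : (EuclideanSpace ℝ (Fin 3))) + ((s + 1 : ℕ) : ℝ) • A τ) - v ((p : (EuclideanSpace ℝ (Fin 3))) + (s : ℝ) • A τ)‖ ^ 2 ≤ M * nnForm t A v := by
    intro s
    obtain ⟨e, he⟩ := exists_sitesShift (t := t) (A := A) (nsmul_mem_Λ₀ hτ s)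
    have hS0 := summable_norm_sub_map_sq (t := t) (A := A) hv (sitesTranslate_injective (t := t) (A := A) hτ)
    have hS : Summable (fun q : Sites₀ t A => ‖v q - v ((q : (EuclideanSpace ℝ (Fin 3))) + A τ)‖ ^ 2) := hS0
    have hpt : ∀ p : Sites₀ t A, ‖v ((p : (EuclideanSpace ℝ (Fin 3))) + ((s + 1 : ℕ) : ℝ) • A τ) - v ((p : (EuclideanSpace ℝ (Fin 3))) + (s : ℝ) • A τ)‖ ^ 2 =
        ‖v ((e p : Sites₀ t A) : (EuclideanSpace ℝ (Fin 3))) - v (((e p : Sites₀ t A) : (EuclideanSpace ℝ (Fin 3))) + A τ)‖ ^ 2 := by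
      intro p
      rw [he p, map_smul, norm_sub_rev]
      congr 2
      · push_cast; rw [add_smul, one_smul, add_assoc]
    refine ⟨(e.summable_iff.2 hS).congr fun p => (hpt p).symm, ?_⟩
    rw [tsum_congr hpt, e.tsum_eq (fun q : Sites₀ t A => ‖v q - v ((q : (EuclideanSpace ℝ (Fin 3))) + A τ)‖ ^ 2)]
    exact hsingle
  -- pointwise telescoping bound, then sum
  have hpt : ∀ p : Sites₀ t A, ‖v ((p : (EuclideanSpace ℝ (Fin 3))) + (L : ℝ) • A τ) - v p‖ ^ 2 ≤ (L : ℝ) * ∑ s ∈ Finset.range L,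
      ‖v ((p : (EuclideanSpace ℝ (Fin 3))) + ((s + 1 : ℕ) : ℝ) • A τ) - v ((p : (EuclideanSpace ℝ (Fin 3))) + (s : ℝ) • A τ)‖ ^ 2 :=
    fun p => norm_sub_iterate_sq_le v (p : (EuclideanSpace ℝ (Fin 3))) (A τ) L
  have hR : Summable (fun p : Sites₀ t A => (L : ℝ) * ∑ s ∈ Finset.range L,
      ‖v ((p : (EuclideanSpace ℝ (Fin 3))) + ((s + 1 : ℕ) : ℝ) • A τ) - v ((p : (EuclideanSpace ℝ (Fin 3))) + (s : ℝ) • A τ)‖ ^ 2) :=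
    (summable_sum fun s _ => (hstep s).1).mul_left _
  have hLHS : Summable (fun p : Sites₀ t A => ‖v ((p : (EuclideanSpace ℝ (Fin 3))) + (L : ℝ) • A τ) - v p‖ ^ 2) :=
    Summable.of_nonneg_of_le (fun p => sq_nonneg _) hpt hR
  have hM : 0 ≤ M * nnForm t A v := by
    have h0 : (0 : ℝ) ≤ ∑' p : Sites₀ t A, ‖v p - v ((p : (EuclideanSpace ℝ (Fin 3))) + A τ)‖ ^ 2 := tsum_nonneg fun _ => sq_nonneg _
    exact h0.trans hsingle
  calc ∑' p : Sites₀ t A, ‖v ((p : (EuclideanSpace ℝ (Fin 3))) + (L : ℝ) • A τ) - v p‖ ^ 2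
      ≤ ∑' p : Sites₀ t A, (L : ℝ) * ∑ s ∈ Finset.range L,
          ‖v ((p : (EuclideanSpace ℝ (Fin 3))) + ((s + 1 : ℕ) : ℝ) • A τ) - v ((p : (EuclideanSpace ℝ (Fin 3))) + (s : ℝ) • A τ)‖ ^ 2 := hLHS.tsum_le_tsum hpt hR
    _ = (L : ℝ) * ∑ s ∈ Finset.range L, ∑' p : Sites₀ t A,
          ‖v ((p : (EuclideanSpace ℝ (Fin 3))) + ((s + 1 : ℕ) : ℝ) • A τ) - v ((p : (EuclideanSpace ℝ (Fin 3))) + (s : ℝ) • A τ)‖ ^ 2 := by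
        rw [tsum_mul_left, Summable.tsum_finsetSum (fun s _ => (hstep s).1)]
    _ ≤ (L : ℝ) * ∑ _s ∈ Finset.range L, M * nnForm t A v :=
        mul_le_mul_of_nonneg_left (Finset.sum_le_sum fun s _ => (hstep s).2) (by positivity)
    _ = M * (L : ℝ) ^ 2 * nnForm t A v := by
        rw [Finset.sum_const, Finset.card_range, nsmul_eq_mul]; ring

/-- The negative of a lattice period is admissible with the same domination constant (step reversed). [folklore] -/
theorem dom_neg {τ : (EuclideanSpace ℝ (Fin 3))} (hτ : τ ∈ Λ₀) {M : ℝ}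
    (hdom : ∀ w : (EuclideanSpace ℝ (Fin 3)) → (EuclideanSpace ℝ (Fin 3)), (Function.support w).Finite →
      ∑' p : Sites₀ t A, ‖w p - w ((p : (EuclideanSpace ℝ (Fin 3))) + A τ)‖ ^ 2 ≤ M * nnForm t A w)
    (w : (EuclideanSpace ℝ (Fin 3)) → (EuclideanSpace ℝ (Fin 3))) (hw : (Function.support w).Finite) :
    ∑' p : Sites₀ t A, ‖w p - w ((p : (EuclideanSpace ℝ (Fin 3))) + A (-τ))‖ ^ 2 ≤ M * nnForm t A w := by
  obtain ⟨e, he⟩ := exists_sitesShift (t := t) (A := A) (neg_mem_Λ₀ hτ)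
  have hpt : ∀ p : Sites₀ t A, ‖w p - w ((p : (EuclideanSpace ℝ (Fin 3))) + A (-τ))‖ ^ 2 =
      ‖w ((e p : Sites₀ t A) : (EuclideanSpace ℝ (Fin 3))) - w (((e p : Sites₀ t A) : (EuclideanSpace ℝ (Fin 3))) + A τ)‖ ^ 2 := by
    intro p
    rw [he p, map_neg, norm_sub_rev]
    congr 2
    rw [add_assoc, neg_add_cancel, add_zero]
  rw [tsum_congr hpt, e.tsum_eq (fun q : Sites₀ t A => ‖w q - w ((q : (EuclideanSpace ℝ (Fin 3))) + A τ)‖ ^ 2)]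
  exact hdom w hw

/-- **Integer multiples of a nearest-neighbour translation** (`±u₁, ±u₂`): for `n : ℤ`,
`Σ'_p ‖v (p + n·Aτ) − v p‖² ≤ n² · nnForm t A v` when `‖Aτ‖ ≤ 11/10`. [folklore] -/
theorem tsum_norm_sub_zsmul_translate_sq_le (hA : Adm₀ A) (hI : Inner₀ t A)
    {v : (EuclideanSpace ℝ (Fin 3)) → (EuclideanSpace ℝ (Fin 3))} (hv : (Function.support v).Finite) {τ : (EuclideanSpace ℝ (Fin 3))} (hτ : τ ∈ Λ₀) (hτn : ‖A τ‖ ≤ 11 / 10) (n : ℤ) :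
    ∑' p : Sites₀ t A, ‖v ((p : (EuclideanSpace ℝ (Fin 3))) + (n : ℝ) • A τ) - v p‖ ^ 2 ≤ (n : ℝ) ^ 2 * nnForm t A v := by
  have hdom : ∀ w : (EuclideanSpace ℝ (Fin 3)) → (EuclideanSpace ℝ (Fin 3)), (Function.support w).Finite →
      ∑' p : Sites₀ t A, ‖w p - w ((p : (EuclideanSpace ℝ (Fin 3))) + A τ)‖ ^ 2 ≤ 1 * nnForm t A w := fun w hw => by
    rw [one_mul]; exact tsum_norm_sub_translate_sq_le_nnForm hA hI hw hτ hτn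
  rcases le_or_gt 0 n with hn | hn
  · have h := tsum_norm_sub_iterate_sq_le (t := t) (A := A) hv hτ hdom n.natAbs
    rw [one_mul] at h
    have hcast : ((n.natAbs : ℕ) : ℝ) = (n : ℝ) := by
      rw [Nat.cast_natAbs, abs_of_nonneg hn]
    rw [hcast] at h
    exact h
  · have hdom' := dom_neg (t := t) (A := A) hτ hdom
    have h := tsum_norm_sub_iterate_sq_le (t := t) (A := A) hv (neg_mem_Λ₀ hτ) hdom' n.natAbs
    rw [one_mul] at h
    have hnat : ((n.natAbs : ℕ) : ℝ) = -(n : ℝ) := by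
      rw [Nat.cast_natAbs, abs_of_neg hn, Int.cast_neg]
    have hcast : ((n.natAbs : ℕ) : ℝ) • A (-τ) = (n : ℝ) • A τ := by
      rw [hnat, map_neg, smul_neg, neg_smul, neg_neg]
    rw [hcast] at h
    have hsq : ((n.natAbs : ℕ) : ℝ) ^ 2 = (n : ℝ) ^ 2 := by rw [hnat, neg_sq]
    rw [hsq] at h
    exact h

/-- **Integer multiples of the vertical period `w₃`**: `Σ'_p ‖v (p + n·A w₃) − v p‖² ≤ 4 n² · nnForm t A v`. [folklore] -/
theorem tsum_norm_sub_zsmul_vertical_sq_le (hA : Adm₀ A) (hI : Inner₀ t A)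
    {v : (EuclideanSpace ℝ (Fin 3)) → (EuclideanSpace ℝ (Fin 3))} (hv : (Function.support v).Finite) (n : ℤ) :
    ∑' p : Sites₀ t A, ‖v ((p : (EuclideanSpace ℝ (Fin 3))) + (n : ℝ) • A (layerNormal (2 * Real.sqrt (2 / 3)))) - v p‖ ^ 2 ≤
      4 * (n : ℝ) ^ 2 * nnForm t A v := by
  have hτ : layerNormal (2 * Real.sqrt (2 / 3)) ∈ Λ₀ := layerNormal_two_mem_Λ₀
  have hdom : ∀ w : (EuclideanSpace ℝ (Fin 3)) → (EuclideanSpace ℝ (Fin 3)), (Function.support w).Finite →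
      ∑' p : Sites₀ t A, ‖w p - w ((p : (EuclideanSpace ℝ (Fin 3))) + A (layerNormal (2 * Real.sqrt (2 / 3))))‖ ^ 2 ≤ 4 * nnForm t A w :=
    fun w hw => tsum_norm_sub_vertical_sq_le_nnForm hA hI hw
  rcases le_or_gt 0 n with hn | hn
  · have h := tsum_norm_sub_iterate_sq_le (t := t) (A := A) hv hτ hdom n.natAbs
    have hcast : ((n.natAbs : ℕ) : ℝ) = (n : ℝ) := by
      rw [Nat.cast_natAbs, abs_of_nonneg hn]
    rw [hcast] at h
    exact h
  · have hdom' := dom_neg (t := t) (A := A) hτ hdom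
    have h := tsum_norm_sub_iterate_sq_le (t := t) (A := A) hv (neg_mem_Λ₀ hτ) hdom' n.natAbs
    have hnat : ((n.natAbs : ℕ) : ℝ) = -(n : ℝ) := by
      rw [Nat.cast_natAbs, abs_of_neg hn, Int.cast_neg]
    have hcast : ((n.natAbs : ℕ) : ℝ) • A (-layerNormal (2 * Real.sqrt (2 / 3))) =
        (n : ℝ) • A (layerNormal (2 * Real.sqrt (2 / 3))) := by
      rw [hnat, map_neg, smul_neg, neg_smul, neg_neg]
    rw [hcast] at h
    have hsq : ((n.natAbs : ℕ) : ℝ) ^ 2 = (n : ℝ) ^ 2 := by rw [hnat, neg_sq]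
    rw [hsq] at h
    exact h

end

end Summit.AtomisticToContinuum.Crystallization.Theorems.ExcessDecayLiouville

end
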